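import Literature.AlgebraicGeometry.HodgeTheory.Sl2IsotypicTimesCMInvariance
import Literature.AlgebraicGeometry.HodgeTheory.Sl2IsotypicTimesCMPartialFFT
import Literature.AlgebraicGeometry.HodgeTheory.Sl2IsotypicDivisorClasses
import Literature.AlgebraicGeometry.HodgeTheory.HodgeClassesProductSpanCriterion
import Literature.AlgebraicGeometry.HodgeTheory.EllipticCurvePowersHodgeClasses
import Literature.AlgebraicGeometry.Milne1999.CodesHCOfCMHodgeHypothesis
import HarnessLib

/-!
# Hodge classes on `B × Z` for `B` with slots over a non-CM `A` of Hodge-group rank three and `Z` with slots over `C` of CM type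
# are spanned by exterior products of Hodge classes of the factors: Lombardo 2016 Lemma 3.4 / Moonen–Zarhin 1999 (3.1)–(3.2)(2)
# PROVED for the `𝔰𝔩₂`-isotypic class (powers of non-CM elliptic curves and of QM abelian surfaces); HC(`Z`) ⟹ HC(`B × Z`)

Family `hodge`, layer `Literature/AlgebraicGeometry/HodgeTheory`.  Written for the cell `pub-hodgecm2` (COR-CM), seat `b27`,
count-neutral lane MT-RANK-FIVE-HODGE (the assembly; predecessors `Sl2IsotypicTimesCMInvariance`,
`Sl2IsotypicTimesCMPartialFFT`, and the cell `pub-hodge-ring2`'s criterion `HodgeClassesProductSpanCriterion`).  UNCONDITIONAL;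
theorems only, no definition, no named fact (D-0026); the conditional statements carry HC of the CM factor as an explicit
hypothesis (never HC_CM as a fact); no step towards a summit statement.

PRINTED RESULT.  D. Lombardo, Ann. Inst. Fourier 66 (2016), Lemma 3.4 (p. 1229): «Suppose `B` is of CM type and `A_K̄` has no
simple factor of type IV. Then `H(A × B) ≅ H(A) × H(B)`»; B. Moonen, Yu. Zarhin, Math. Ann. 315 (1999), §3 (3.1)–(3.2)(2):
then the Hodge ring of every `A^m × B^n` is generated by the classes coming from `B(A^m)` and `B(B^n)` — the tree's named fact
`Lombardo2016_hodgeClassesProductSpan` (`HodgeTheory/HodgeGroupProductCMFactor`).  THIS FILE PROVES its conclusion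
`HodgeClassesProductSpan B Z` for `B` an abelian variety with slots over `A` (`AVSlots`, e.g. `B = A^{N+1}`), `A` NOT of CM type
with `dim_ℚ Lie Hg(H¹A) ≤ 3` (Moonen–Zarhin Types I(1) `Hg = SL₂` and II(1) `Hg = SL₁(D)`: non-CM elliptic curves and abelian
surfaces with quaternionic multiplication — Gordon §7.3.2, Murty), and `Z` with the same number of slots over `C` of CM type
(`Milne1999.IsOfCMType`; e.g. `Z = C^{N+1}`).

MAIN RESULTS (all proved):
* §1 `AVSlots.prodMap` — slots of `B` over `A` and of `Z` over `C` (the same number) give slots of `B × Z` over `A × C`;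
  `mem_span_hodgeProductClasses_of_degree_zero` (`H⁰ = ℂ · 1 = ℂ · pr_B^*1 ⌣ pr_Z^*1`).
* §2 **`AVSlots.hodgeClassesProductSpan_prod_of_finrank_hodgeLie_le_three_of_isOfCMType`**: `HodgeClassesProductSpan B Z`
  (invariance theorem + relative first fundamental theorem + criterion); the binder shape
  `AVSlots.lombardo2016_hodgeClassesProductSpan_of_finrank_hodgeLie_le_three`; **HC(`Z`) ⟹ HC(`B × Z`)**
  (`hodgeConjectureFor_prod_of_productSpan` with the lane MT-RANK-FOUR-DIVISORS' unconditional HC for `B`).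
* §3 powers: `HodgeClassesProductSpan (A^{N+1}) (C^{N+1})`, HC(`C^{N+1}`) ⟹ HC(`A^{N+1} × C^{N+1}`), and UNCONDITIONALLY
  **HC(`A^{N+1} × E^{N+1}`) for `E` any CM elliptic curve** (Tate / van Geemen Thm. 4.3 for `E^{N+1}`,
  `EllipticCurve.hodgeConjectureFor_powSucc`) — the Hodge side of the Mumford–Tate-rank-five shape `Hg = SL₂ × U(1)`
  (`Summits/HodgeConjecture/CorCM/MumfordTateRankFive`).

## References
* [Lombardo2016] D. Lombardo, Ann. Inst. Fourier 66 (2016), Lemma 3.4 (p. 1229). [cite: Lombardo2016, Lemma 3.4 (p. 1229)]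
* [MoonenZarhin1999LowDim] B. Moonen, Yu. Zarhin, Math. Ann. 315 (1999), §2 (2.1)–(2.2), §3 (3.1)–(3.2), (3.8).
  [cite: MoonenZarhin1999LowDim, §3 (3.1)–(3.2)]
* [Gordon1997] B. B. Gordon, App. B of Lewis (1999) = arXiv:alg-geom/9709030, §3, §7.3.2, Thm. 7.5. [cite: Gordon1997, §7.3.2 and Thm. 7.5]
* [vanGeemen1994HodgeAV] B. van Geemen, LNM 1594 (1994), Lemma 3.7, Thm. 4.3. [cite: vanGeemen1994HodgeAV, Thm. 4.3]
* [VoisinHodgeII2003] C. Voisin, *Hodge Theory II*, proof of Prop. 9.20. [cite: VoisinHodgeII2003, proof of Prop. 9.20 (first display)]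
* [HatcherAT2002] A. Hatcher, *Algebraic Topology* (2002), §3.2 Thm. 3.16. [cite: HatcherAT2002, §3.2 Thm. 3.16]
-/

noncomputable section

open CategoryTheory MonoidalCategory Module

namespace Literature.AlgebraicGeometry.HodgeTheory

open Literature.AlgebraicTopology.SingularHomology
open Literature.AlgebraicGeometry.Motives
open Literature.Barriers.HodgeConjecture
open Literature.AlgebraicGeometry.Motives.HodgeStructure
open Literature.AlgebraicGeometry.ComplexMultiplication
open Literature.RepresentationTheory.GeneralLinear
open Literature.NumberTheory.DiophantineGeometry

/-! ### §1 Slots of `B × Z` over `A × C`; Hodge classes of degree `0` on a product -/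

section Slots

variable {A C B Z : AbelianVariety ℂ} {n : ℕ} {gA : Fin n → (B ⟶ A)} {gC : Fin n → (Z ⟶ C)}

/-- **Slots multiply across a product of bases**: if `B` has `n` slots `gA_j` over `A` and `Z` has `n` slots `gC_j` over `C`,
then `B × Z` has the `n` slots `gA_j × gC_j` over `A × C` (`dim(B × Z) = n (dim A + dim C)`, and `H¹(B × Z) = pr_B^* H¹(B) ⊕
pr_Z^* H¹(Z)` with `pr_B^* gA_j^* = (gA_j × gC_j)^* pr_A^*`; Künneth in degree one). [cite: HatcherAT2002, §3.2 Thm. 3.16]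
[cite: MoonenZarhin1999LowDim, §3 (3.1)] -/
theorem AVSlots.prodMap (hB : AVSlots A B gA) (hZ : AVSlots C Z gC) :
    AVSlots (A.prod C) (B.prod Z) (fun j => AbelianVariety.prodMap (gA j) (gC j)) := by
  refine ⟨by rw [AbelianVariety.dim_prod, AbelianVariety.dim_prod, hB.1, hZ.1, mul_add], fun x => ?_⟩
  have hBs : IsSmoothProjective B.dim B.X := AbelianVariety.isSmoothProjective_holds
  have hZs : IsSmoothProjective Z.dim Z.X := AbelianVariety.isSmoothProjective_holds
  set S := Submodule.span ℂ (Set.range fun p : Fin n × complexBetti (A.prod C).X 1 =>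
    complexBetti.map (AbelianVariety.prodMap (gA p.1) (gC p.1)).hom.hom.hom 1 p.2) with hS
  obtain ⟨a, b, hab⟩ := exists_eq_map_fst_add_map_snd_deg_one hBs hZs x
  change x = complexBetti.map (AbelianVariety.fst B Z).hom.hom.hom 1 a +
    complexBetti.map (AbelianVariety.snd B Z).hom.hom.hom 1 b at hab
  have hfst : ∀ (j : Fin n) (y : complexBetti A.X 1),
      complexBetti.map (AbelianVariety.fst B Z).hom.hom.hom 1 (complexBetti.map (gA j).hom.hom.hom 1 y) ∈ S := by
    intro j y
    refine Submodule.subset_span ⟨(j, complexBetti.map (AbelianVariety.fst A C).hom.hom.hom 1 y), ?_⟩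
    change complexBetti.map (AbelianVariety.prodMap (gA j) (gC j)).hom.hom.hom 1
      (complexBetti.map (AbelianVariety.fst A C).hom.hom.hom 1 y) = _
    rw [abelianVarietyHom_map_map_apply, AbelianVariety.prodMap_fst, ← abelianVarietyHom_map_map_apply]
  have hsnd : ∀ (j : Fin n) (y : complexBetti C.X 1),
      complexBetti.map (AbelianVariety.snd B Z).hom.hom.hom 1 (complexBetti.map (gC j).hom.hom.hom 1 y) ∈ S := by
    intro j y
    refine Submodule.subset_span ⟨(j, complexBetti.map (AbelianVariety.snd A C).hom.hom.hom 1 y), ?_⟩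
    change complexBetti.map (AbelianVariety.prodMap (gA j) (gC j)).hom.hom.hom 1
      (complexBetti.map (AbelianVariety.snd A C).hom.hom.hom 1 y) = _
    rw [abelianVarietyHom_map_map_apply, AbelianVariety.prodMap_snd, ← abelianVarietyHom_map_map_apply]
  -- push the two spans through the pull-backs
  have ha : complexBetti.map (AbelianVariety.fst B Z).hom.hom.hom 1 a ∈ S := by
    refine Submodule.span_induction (p := fun a _ => complexBetti.map (AbelianVariety.fst B Z).hom.hom.hom 1 a ∈ S)
      ?_ ?_ ?_ ?_ (hB.2 a)
    · rintro _ ⟨⟨j, y⟩, rfl⟩; exact hfst j y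
    · rw [map_zero]; exact Submodule.zero_mem _
    · intro x y _ _ hx hy; rw [map_add]; exact Submodule.add_mem _ hx hy
    · intro s x _ hx; rw [map_smul]; exact Submodule.smul_mem _ s hx
  have hb : complexBetti.map (AbelianVariety.snd B Z).hom.hom.hom 1 b ∈ S := by
    refine Submodule.span_induction (p := fun b _ => complexBetti.map (AbelianVariety.snd B Z).hom.hom.hom 1 b ∈ S)
      ?_ ?_ ?_ ?_ (hZ.2 b)
    · rintro _ ⟨⟨j, y⟩, rfl⟩; exact hsnd j y
    · rw [map_zero]; exact Submodule.zero_mem _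
    · intro x y _ _ hx hy; rw [map_add]; exact Submodule.add_mem _ hx hy
    · intro s x _ hx; rw [map_smul]; exact Submodule.smul_mem _ s hx
  rw [hab]
  exact Submodule.add_mem _ ha hb

/-- **Degree zero**: a rational class in `H⁰((B × Z)(ℂ); ℂ) = ℂ · 1` is a multiple of `pr_B^* 1 ⌣ pr_Z^* 1`, an exterior
product of rational `(0,0)`-classes. [cite: HatcherAT2002, §3.2 Thm. 3.16] -/
theorem mem_span_hodgeProductClasses_of_degree_zero (B Z : AbelianVariety ℂ) (c : complexBetti (B.X ⊗ Z.X) (2 * 0)) :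
    c ∈ Submodule.span ℂ (hodgeProductClasses B Z 0) := by
  obtain ⟨M₁⟩ := nonempty_hodgeModel_holds (AbelianVariety.isSmoothProjective_holds (A := B))
  obtain ⟨M₂⟩ := nonempty_hodgeModel_holds (AbelianVariety.isSmoothProjective_holds (A := Z))
  have hone₁ : IsRationalClass (singularCohomology.one ℂ (Motives.ComplexPoints B.X)) := isRationalClass_one _
  have hone₂ : IsRationalClass (singularCohomology.one ℂ (Motives.ComplexPoints Z.X)) := isRationalClass_one _
  have hone₁' : IsOfHodgeType B.dim B.X (2 * 0) 0 0 (singularCohomology.one ℂ (Motives.ComplexPoints B.X)) :=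
    isOfHodgeType_zero_zero_zero M₁ _
  have hone₂' : IsOfHodgeType Z.dim Z.X (2 * 0) 0 0 (singularCohomology.one ℂ (Motives.ComplexPoints Z.X)) :=
    isOfHodgeType_zero_zero_zero M₂ _
  change ↥(complexBetti (B.prod Z).X 0) at c
  have hΛ := Motives.AbelianVariety.hasExteriorCohomologyH1_complexPoints (B.prod Z)
  have hrange : Set.range (cupPowOne ℂ (Motives.ComplexPoints (B.prod Z).X) 0) =
      {singularCohomology.one ℂ (Motives.ComplexPoints (B.prod Z).X)} := by
    ext x
    simp only [Set.mem_range, cupPowOne_zero, Set.mem_singleton_iff]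
    exact ⟨fun ⟨_, h⟩ => h.symm, fun h => ⟨Fin.elim0, h.symm⟩⟩
  have hc1 : c ∈ Submodule.span ℂ {singularCohomology.one ℂ (Motives.ComplexPoints (B.prod Z).X)} := by
    rw [← hrange, hΛ.span_range_cupPowOne 0]
    exact Submodule.mem_top
  obtain ⟨t, rfl⟩ := Submodule.mem_span_singleton.1 hc1
  have hone : cupProduct (X := Motives.ComplexPoints (B.X ⊗ Z.X)) (two_mul_add_two_mul 0 0)
      ((complexBetti.map (AbelianVariety.fst B Z).hom.hom.hom (2 * 0)).hom
        (singularCohomology.one ℂ (Motives.ComplexPoints B.X)))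
      ((complexBetti.map (AbelianVariety.snd B Z).hom.hom.hom (2 * 0)).hom
        (singularCohomology.one ℂ (Motives.ComplexPoints Z.X))) =
      singularCohomology.one ℂ (Motives.ComplexPoints (B.prod Z).X) := by
    change cupProduct (p := 0) (q := 0) (n := 0) _
      (singularCohomology.map ℂ ℂ _ 0 (singularCohomology.one ℂ _))
      (singularCohomology.map ℂ ℂ _ 0 (singularCohomology.one ℂ _)) = _
    rw [singularCohomology.map_one, singularCohomology.map_one]
    exact cupProduct_one _
  have h : t • cupProduct (X := Motives.ComplexPoints (B.X ⊗ Z.X)) (two_mul_add_two_mul 0 0)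
      ((complexBetti.map (AbelianVariety.fst B Z).hom.hom.hom (2 * 0)).hom
        (singularCohomology.one ℂ (Motives.ComplexPoints B.X)))
      ((complexBetti.map (AbelianVariety.snd B Z).hom.hom.hom (2 * 0)).hom
        (singularCohomology.one ℂ (Motives.ComplexPoints Z.X))) ∈ Submodule.span ℂ (hodgeProductClasses B Z 0) :=
    Submodule.smul_mem _ t (Submodule.subset_span ⟨0, 0, two_mul_add_two_mul 0 0, _, _, hone₁, hone₁', hone₂, hone₂', rfl⟩)
  rw [hone] at h
  exact h

end Slots

/-! ### §2 The theorem: `HodgeClassesProductSpan B Z`; HC(`Z`) ⟹ HC(`B × Z`) -/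

section ProductSpan

variable {A C B Z : AbelianVariety ℂ} {n : ℕ} {gA : Fin n → (B ⟶ A)} {gC : Fin n → (Z ⟶ C)}

/-- **Lombardo 2016 Lemma 3.4 / Moonen–Zarhin 1999 (3.1)–(3.2)(2) on Hodge classes, PROVED for the `𝔰𝔩₂`-isotypic class.**
Let `A` be a complex abelian variety NOT of CM type with `dim_ℚ Lie Hg(H¹A) ≤ 3` (non-CM elliptic curves, QM abelian surfaces),
`B` an abelian variety with `n` slots over `A`, `C` of CM type and `Z` an abelian variety with `n` slots over `C`.  Then every
rational `(p,p)`-class on `B × Z` is a `ℂ`-combination of exterior products `pr_B^* a ⌣ pr_Z^* b` of rational Hodge classes of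
`B` and of `Z` (`HodgeClassesProductSpan B Z`).  PROOF: the invariance theorem on `X = B × Z` with the slots `gA_j × gC_j`
over `A × C` (`AVSlots.exists_coeff_killed_at_isotypic_places_of_prod_cmType`), the relative first fundamental theorem
(`wordEval_mem_span_divisor_cup_typed_of_isotypic`; crossed classes by `sl2Cross_mem_span_rational_oneOne`), and the criterion
`mem_span_hodgeProductClasses_of_mem_span_typed` (Künneth uniqueness, rationality, type projectors).
[cite: Lombardo2016, Lemma 3.4 (p. 1229)] [cite: MoonenZarhin1999LowDim, §3 (3.1)–(3.2)] [cite: Gordon1997, §7.3.2 and Thm. 7.5] -/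
theorem AVSlots.hodgeClassesProductSpan_prod_of_finrank_hodgeLie_le_three_of_isOfCMType [HodgeTensorFacts.{0, 0}]
    (hB : AVSlots A B gA) (hZ : AVSlots C Z gC)
    (hne : haveI := BettiUniverse.finite (AbelianVariety.isSmoothProjective_holds (A := A)) 1
      ¬ (BettiUniverse.hodge exists_isReal_hodgeModel_holds (AbelianVariety.isSmoothProjective_holds (A := A)) 1).hodgeLie
        ≤ Subalgebra.toSubmodule
          (BettiUniverse.hodge exists_isReal_hodgeModel_holds (AbelianVariety.isSmoothProjective_holds (A := A)) 1).endAlg)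
    (h3 : haveI := BettiUniverse.finite (AbelianVariety.isSmoothProjective_holds (A := A)) 1
      Module.finrank ℚ (BettiUniverse.hodge exists_isReal_hodgeModel_holds
        (AbelianVariety.isSmoothProjective_holds (A := A)) 1).hodgeLie ≤ 3)
    (hC : Milne1999.IsOfCMType C) : HodgeClassesProductSpan B Z := by
  classical
  intro p c hcQ hc
  rcases Nat.eq_zero_or_pos p with rfl | hp
  · exact mem_span_hodgeProductClasses_of_degree_zero B Z c
  have hXA : IsSmoothProjective A.dim A.X := AbelianVariety.isSmoothProjective_holds
  have hXC : IsSmoothProjective C.dim C.X := AbelianVariety.isSmoothProjective_holds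
  have hXB : IsSmoothProjective B.dim B.X := AbelianVariety.isSmoothProjective_holds
  have hXZ : IsSmoothProjective Z.dim Z.X := AbelianVariety.isSmoothProjective_holds
  have hHD : exists_isReal_hodgeModel := exists_isReal_hodgeModel_holds
  have hI : hodgePQ_independent_of_hodgeModel := hodgePQ_independent_of_hodgeModel_holds
  haveI : Module.Finite ℚ (bettiCohomology A.X 1) := BettiUniverse.finite hXA 1
  set H := BettiUniverse.hodge hHD hXA 1 with hHdef
  have hH : H.IsEffective := BettiUniverse.hodge_isEffective hHD hXA 1
  obtain ⟨ψ⟩ := BettiUniverse.hodge_isPolarizable hHD hXA 1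
  obtain ⟨X₀, hX₀, hX₀E⟩ := SetLike.not_le_iff_exists.1 hne
  rw [Subalgebra.mem_toSubmodule] at hX₀E
  obtain ⟨S, deg, e, hF, hFc⟩ := exists_basis_F_eq_span H
  haveI : Fintype S := FiniteDimensional.fintypeBasisIndex e
  obtain ⟨b, hb0, hb1⟩ := HodgeStructure.exists_pairBasis H ψ rfl hH e hF hFc hX₀ hX₀E h3
  -- the invariance theorem on `X = B × Z` with slots over `A × C`
  have hg := hB.prodMap hZ
  have hc' : IsOfHodgeType (B.prod Z).dim (B.prod Z).X (2 * p) p p c := by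
    rw [AbelianVariety.dim_prod]; exact hc
  obtain ⟨h, cC, hcC0, hcC1, hmain⟩ :=
    hg.exists_coeff_killed_at_isotypic_places_of_prod_cmType hHD hI ψ e hF hFc hX₀ hX₀E h3 b hb0 hb1 hC
  obtain ⟨a, ha, hkill⟩ := hmain hp hcQ hc'
  -- the two-sorted letters, read through `pr_B`, `pr_Z`
  set ρA := ofRatClassBaseChange (Motives.ComplexPoints A.X) 1 with hρA
  set ρC := ofRatClassBaseChange (Motives.ComplexPoints C.X) 1 with hρC
  set yA : (Fin n × {σ : S // deg σ = 1}) × Fin 2 → complexBetti B.X 1 :=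
    fun jtr => avLetters gA (fun τr => ρA (b τr)) (jtr.1.1, (jtr.1.2, jtr.2)) with hyA
  set yC : (Fin n × Fin h) × Fin 2 → complexBetti Z.X 1 :=
    fun jir => avLetters gC (fun ir => ρC (cC ir)) (jir.1.1, (jir.1.2, jir.2)) with hyC
  have hletters : (fun jr : (Fin n × ({σ : S // deg σ = 1} ⊕ Fin h)) × Fin 2 =>
      complexBetti.map (AbelianVariety.prodMap (gA jr.1.1) (gC jr.1.1)).hom.hom.hom 1
        (Sum.elim (fun τ => complexBetti.map (AbelianVariety.fst A C).hom.hom.hom 1 (ρA (b (τ, jr.2))))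
          (fun i => complexBetti.map (AbelianVariety.snd A C).hom.hom.hom 1 (ρC (cC (i, jr.2)))) jr.1.2)) =
      fun jr : (Fin n × ({σ : S // deg σ = 1} ⊕ Fin h)) × Fin 2 => Sum.elim
        (fun τ => complexBetti.map (AbelianVariety.fst B Z).hom.hom.hom 1 (yA ((jr.1.1, τ), jr.2)))
        (fun i => complexBetti.map (AbelianVariety.snd B Z).hom.hom.hom 1 (yC ((jr.1.1, i), jr.2))) jr.1.2 := by
    funext jr
    obtain ⟨⟨j, t⟩, r⟩ := jr
    rcases t with τ | i
    · simp only [Sum.elim_inl, hyA, avLetters_apply]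
      rw [abelianVarietyHom_map_map_apply, AbelianVariety.prodMap_fst, ← abelianVarietyHom_map_map_apply]
    · simp only [Sum.elim_inr, hyC, avLetters_apply]
      rw [abelianVarietyHom_map_map_apply, AbelianVariety.prodMap_snd, ← abelianVarietyHom_map_map_apply]
  rw [hletters] at ha
  -- crossed classes of the `A`-letters are divisorial; the `C`-letters are Hodge-adapted
  have hcross : ∀ i j : Fin n × {σ : S // deg σ = 1},
      cupProduct (rfl : 1 + 1 = 2) (yA (i, 0)) (yA (j, 1)) + cupProduct (rfl : 1 + 1 = 2) (yA (j, 0)) (yA (i, 1)) ∈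
        Submodule.span ℂ {b : complexBetti B.X 2 | IsRationalClass b ∧ IsOfHodgeType B.dim B.X 2 1 1 b} :=
    fun i j => sl2Cross_mem_span_rational_oneOne (g := gA) hHD hI ψ e hF hFc hX₀ hX₀E h3 b hb0 hb1 i j
  have hyC0 : ∀ l : Fin n × Fin h, IsOfHodgeType Z.dim Z.X 1 1 0 (yC (l, 0)) := fun l =>
    ((BettiUniverse.mem_hodge_piece_iff hHD hI hXC (k := 1) (p := 1) (q := 0) rfl _).1 (hcC0 l.2)).map_of_isSmoothProjective
      hXZ hXC _
  have hyC1 : ∀ l : Fin n × Fin h, IsOfHodgeType Z.dim Z.X 1 0 1 (yC (l, 1)) := fun l =>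
    ((BettiUniverse.mem_hodge_piece_iff hHD hI hXC (k := 1) (p := 0) (q := 1) rfl _).1 (hcC1 l.2)).map_of_isSmoothProjective
      hXZ hXC _
  -- the relative first fundamental theorem, then the criterion
  have hmem := wordEval_mem_span_divisor_cup_typed_of_isotypic (AbelianVariety.fst B Z) (AbelianVariety.snd B Z) yA hcross
    yC hyC0 hyC1 (fun U => (hkill U).1) (fun U => (hkill U).2)
  rw [ha] at hmem
  exact mem_span_hodgeProductClasses_of_mem_span_typed B Z hcQ hc hmem

/-- **The binder shape of `Lombardo2016_hodgeClassesProductSpan`, discharged on this class**: for `B` with slots over a non-CM `A`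
of Hodge-group rank three, the instance `HasNoTypeIVFactor B → IsOfCMType Z → HodgeClassesProductSpan B Z` of the named fact holds
for every `Z` with as many slots over a CM-type `C` (the type-IV hypothesis is not used: `Hg(B) = SL₂` acting isotypically).
[cite: Lombardo2016, Lemma 3.4 (p. 1229)] [cite: MoonenZarhin1999LowDim, §3 (3.2)] -/
theorem AVSlots.lombardo2016_hodgeClassesProductSpan_of_finrank_hodgeLie_le_three [HodgeTensorFacts.{0, 0}]
    (hB : AVSlots A B gA) (hZ : AVSlots C Z gC)
    (hne : haveI := BettiUniverse.finite (AbelianVariety.isSmoothProjective_holds (A := A)) 1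
      ¬ (BettiUniverse.hodge exists_isReal_hodgeModel_holds (AbelianVariety.isSmoothProjective_holds (A := A)) 1).hodgeLie
        ≤ Subalgebra.toSubmodule
          (BettiUniverse.hodge exists_isReal_hodgeModel_holds (AbelianVariety.isSmoothProjective_holds (A := A)) 1).endAlg)
    (h3 : haveI := BettiUniverse.finite (AbelianVariety.isSmoothProjective_holds (A := A)) 1
      Module.finrank ℚ (BettiUniverse.hodge exists_isReal_hodgeModel_holds
        (AbelianVariety.isSmoothProjective_holds (A := A)) 1).hodgeLie ≤ 3)
    (hC : Milne1999.IsOfCMType C) :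
    HasNoTypeIVFactor B → Milne1999.IsOfCMType Z → HodgeClassesProductSpan B Z :=
  fun _ _ => hB.hodgeClassesProductSpan_prod_of_finrank_hodgeLie_le_three_of_isOfCMType hZ hne h3 hC

/-- **HC(`Z`) ⟹ HC(`B × Z`)** for `B` with slots over a non-CM `A` of Hodge-group rank three and `Z` with as many slots over
a CM-type `C` (exterior products of algebraic classes are algebraic, `hodgeConjectureFor_prod_of_productSpan`; HC for `B` is
the UNCONDITIONAL `AVSlots.hodgeConjectureFor_of_finrank_hodgeLie_le_three`, Murty 1984 / Gordon Thm. 7.5).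
[cite: MoonenZarhin1999LowDim, §3 (3.2) and (3.8)] [cite: VoisinHodgeII2003, proof of Prop. 9.20 (first display)]
[cite: Gordon1997, §7.3.2 and Thm. 7.5] -/
theorem AVSlots.hodgeConjectureFor_prod_of_finrank_hodgeLie_le_three_of_isOfCMType [HodgeTensorFacts.{0, 0}]
    (hB : AVSlots A B gA) (hZ : AVSlots C Z gC)
    (hne : haveI := BettiUniverse.finite (AbelianVariety.isSmoothProjective_holds (A := A)) 1
      ¬ (BettiUniverse.hodge exists_isReal_hodgeModel_holds (AbelianVariety.isSmoothProjective_holds (A := A)) 1).hodgeLie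
        ≤ Subalgebra.toSubmodule
          (BettiUniverse.hodge exists_isReal_hodgeModel_holds (AbelianVariety.isSmoothProjective_holds (A := A)) 1).endAlg)
    (h3 : haveI := BettiUniverse.finite (AbelianVariety.isSmoothProjective_holds (A := A)) 1
      Module.finrank ℚ (BettiUniverse.hodge exists_isReal_hodgeModel_holds
        (AbelianVariety.isSmoothProjective_holds (A := A)) 1).hodgeLie ≤ 3)
    (hC : Milne1999.IsOfCMType C) (hZHC : HodgeConjectureFor Z.dim Z.X) :
    HodgeConjectureFor (B.prod Z).dim (B.prod Z).X :=
  hodgeConjectureFor_prod_of_productSpan B Z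
    (hB.hodgeClassesProductSpan_prod_of_finrank_hodgeLie_le_three_of_isOfCMType hZ hne h3 hC)
    (hB.hodgeConjectureFor_of_finrank_hodgeLie_le_three hne h3) hZHC

end ProductSpan

/-! ### §3 Powers: `A^{N+1} × C^{N+1}`, and unconditionally `A^{N+1} × E^{N+1}` for a CM elliptic curve `E` -/

section Powers

variable {A C : AbelianVariety ℂ}

/-- **`B(A^{N+1} × C^{N+1})` is spanned by exterior products of Hodge classes of `A^{N+1}` and of `C^{N+1}`** for `A` NOT of
CM type with `dim_ℚ Lie Hg(H¹A) ≤ 3` and `C` of CM type — Moonen–Zarhin's (3.1) «`B(X₁^m × X₂^n)` is generated by the elements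
coming from `B(X₁^m)` and `B(X₂^n)`» (equal exponents; the slots are the projections `avPowSlots`).
[cite: MoonenZarhin1999LowDim, §3 (3.1)–(3.2)] [cite: Lombardo2016, Lemma 3.4 (p. 1229)] -/
theorem hodgeClassesProductSpan_powSucc_of_finrank_hodgeLie_le_three_of_isOfCMType [HodgeTensorFacts.{0, 0}]
    (hne : haveI := BettiUniverse.finite (AbelianVariety.isSmoothProjective_holds (A := A)) 1
      ¬ (BettiUniverse.hodge exists_isReal_hodgeModel_holds (AbelianVariety.isSmoothProjective_holds (A := A)) 1).hodgeLie
        ≤ Subalgebra.toSubmodule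
          (BettiUniverse.hodge exists_isReal_hodgeModel_holds (AbelianVariety.isSmoothProjective_holds (A := A)) 1).endAlg)
    (h3 : haveI := BettiUniverse.finite (AbelianVariety.isSmoothProjective_holds (A := A)) 1
      Module.finrank ℚ (BettiUniverse.hodge exists_isReal_hodgeModel_holds
        (AbelianVariety.isSmoothProjective_holds (A := A)) 1).hodgeLie ≤ 3)
    (hC : Milne1999.IsOfCMType C) (N : ℕ) : HodgeClassesProductSpan (A.powSucc N) (C.powSucc N) :=
  (AVSlots.powSucc A N).hodgeClassesProductSpan_prod_of_finrank_hodgeLie_le_three_of_isOfCMType (AVSlots.powSucc C N) hne h3 hC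

/-- **HC(`C^{N+1}`) ⟹ HC(`A^{N+1} × C^{N+1}`)** for `A` NOT of CM type with `dim_ℚ Lie Hg(H¹A) ≤ 3` and `C` of CM type (HC for
`A^{N+1}` is unconditional, Murty 1984; HC for the CM factor is the hypothesis — never HC_CM as a fact).
[cite: MoonenZarhin1999LowDim, §3 (3.2) and (3.8)] [cite: Gordon1997, §7.3.2 and Thm. 7.5] -/
theorem hodgeConjectureFor_powSucc_prod_powSucc_of_finrank_hodgeLie_le_three_of_isOfCMType [HodgeTensorFacts.{0, 0}]
    (hne : haveI := BettiUniverse.finite (AbelianVariety.isSmoothProjective_holds (A := A)) 1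
      ¬ (BettiUniverse.hodge exists_isReal_hodgeModel_holds (AbelianVariety.isSmoothProjective_holds (A := A)) 1).hodgeLie
        ≤ Subalgebra.toSubmodule
          (BettiUniverse.hodge exists_isReal_hodgeModel_holds (AbelianVariety.isSmoothProjective_holds (A := A)) 1).endAlg)
    (h3 : haveI := BettiUniverse.finite (AbelianVariety.isSmoothProjective_holds (A := A)) 1
      Module.finrank ℚ (BettiUniverse.hodge exists_isReal_hodgeModel_holds
        (AbelianVariety.isSmoothProjective_holds (A := A)) 1).hodgeLie ≤ 3)
    (hC : Milne1999.IsOfCMType C) (N : ℕ)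
    (hHC : HodgeConjectureFor (C.powSucc N).dim (C.powSucc N).X) :
    HodgeConjectureFor ((A.powSucc N).prod (C.powSucc N)).dim ((A.powSucc N).prod (C.powSucc N)).X :=
  (AVSlots.powSucc A N).hodgeConjectureFor_prod_of_finrank_hodgeLie_le_three_of_isOfCMType (AVSlots.powSucc C N) hne h3 hC hHC

/-- **UNCONDITIONAL: the Hodge conjecture for `A^{N+1} × E^{N+1}`**, `A` a complex abelian variety NOT of CM type with
`dim_ℚ Lie Hg(H¹A) ≤ 3` (a non-CM elliptic curve or an abelian surface with quaternionic multiplication, and everything with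
slots over it) and `E` an elliptic curve with complex multiplication (`dim E = 1`, `E` of CM type) — the Hodge group
`SL₂ × U(1)` of Moonen–Zarhin; HC for `E^{N+1}` is Tate's theorem / van Geemen Thm. 4.3 (`EllipticCurve.hodgeConjectureFor_powSucc`).
[cite: MoonenZarhin1999LowDim, §2 (2.1)–(2.2) and §3 (3.2)] [cite: vanGeemen1994HodgeAV, Thm. 4.3]
[cite: Gordon1997, §7.3.2 and Thm. 7.5] -/
theorem hodgeConjectureFor_powSucc_prod_powSucc_of_finrank_hodgeLie_le_three_of_cmCurve [HodgeTensorFacts.{0, 0}]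
    (hne : haveI := BettiUniverse.finite (AbelianVariety.isSmoothProjective_holds (A := A)) 1
      ¬ (BettiUniverse.hodge exists_isReal_hodgeModel_holds (AbelianVariety.isSmoothProjective_holds (A := A)) 1).hodgeLie
        ≤ Subalgebra.toSubmodule
          (BettiUniverse.hodge exists_isReal_hodgeModel_holds (AbelianVariety.isSmoothProjective_holds (A := A)) 1).endAlg)
    (h3 : haveI := BettiUniverse.finite (AbelianVariety.isSmoothProjective_holds (A := A)) 1
      Module.finrank ℚ (BettiUniverse.hodge exists_isReal_hodgeModel_holds
        (AbelianVariety.isSmoothProjective_holds (A := A)) 1).hodgeLie ≤ 3)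
    {E : AbelianVariety ℂ} (hE : E.dim = 1) (hEcm : Milne1999.IsOfCMType E) (N : ℕ) :
    HodgeConjectureFor ((A.powSucc N).prod (E.powSucc N)).dim ((A.powSucc N).prod (E.powSucc N)).X :=
  hodgeConjectureFor_powSucc_prod_powSucc_of_finrank_hodgeLie_le_three_of_isOfCMType hne h3 hEcm N
    (EllipticCurve.hodgeConjectureFor_powSucc hE N)

end Powers

end Literature.AlgebraicGeometry.HodgeTheory

end
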